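import Literature.MathematicalPhysics.QuantumFieldTheory.Balaban1983to89.B8Ineq165Descent

/-!
# `Balaban1983to89.B8Ineq165Local` — T. Bałaban, *Spaces of regular gauge field configurations on a lattice and gauge
# fixing conditions*, Commun. Math. Phys. **99** (1985) 75–102 [Balaban1985RegularSpaces] ("B8"), p. 87 **(1.65)**,
# LOCAL CARRIER: the general-background descent of `B8Ineq165Descent` with the regularity (1.33)/(1.34) assumed on the
# plaquettes of the cube `□̃` ONLY (as (1.7) is stated in print: "for p ∈ Ω_j")

statement-level skeleton of published theorems with citation tags; proofs where landed; nothing here is a claim about the Yang–Mills mass gap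

PDF held: `paper:balaban1985-cmp99-regular-spaces-gauge-fixing` (journal page = PDF page + 74; p. 87 = PDF p. 13, p. 77
(1.7) = PDF p. 3).

WHAT IS REPRODUCED (mega-formalization `lit-balaban`, HOME `run/shared/lean/pub/lit-balaban/`, Phase-2 seat p26,
generation 6; SKELETON row **B8.Eq1.65** (reader r05, referee ref-4); companion of `B8Ineq165Descent` (p253539), whose
printed theorem `ineq165_global` takes (1.7) in the global sup form on all of `ℤ^d`).  P. 77 (1.7), verbatim: *"|U(∂p) −
1| < α₀L^{−2j} for p ∈ Ω_j, j = 0, 1, …, k"* — a condition on the plaquettes of the DOMAINS `Ω_j`; p. 87 (1.65): *"Thus the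
conditions (1.33)–(1.35) imply |(\overline{U′U₀})ʲ − Ū₀ʲ| = |Ũ′ʲ − 1| < 11d²α₀ + α₁ on Ω_j^{(j)}"*.  Here: (1.33)/(1.34)
regularity at the top level for `U₀` and `U = U′U₀` on the unit plaquettes of the finest cube `□̃ = [tlo k, thi k]` only
(`B7Prop1Local.pdevOn`), everything else as in `B8Ineq165Descent.ineq165_global` ⟹ the same conclusion
`|Ūʲ(b) − Ū₀ʲ(b)| ≤ 8d²α₀(L^{−2(k−j−1)} + … + 1) + α₁ < 11d²α₀ + α₁` on the bonds of `□̃^{(j)}`.  Proof = the tree's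
localisation device of `B8Ineq130.ineq130_local`: the clamped extensions `π*U₀`, `π*U` (`B7Prop1Local.clampCfg`) satisfy
(1.7) everywhere (`pdev_clampCfg_le`), the global theorem applies to them, and their averages agree with those of `U₀`,
`U` on the tower of cubes (`B8Ineq130.agree_level` — the printed locality of (43), [Balaban1985Averaging] p. 24), which
transfers the relative axial gauge (1.19), the top closeness (1.35) and the conclusion.

HONEST SCOPE.  As `B8Ineq165Descent` (tower of cubes, `AvgClosed` value group, (1.35) at the top level, `≤`/`<` as the
inputs allow); only the carrier of (1.7) changes (local instead of global).  Every declaration is a proved theorem; no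
`def`, no new `Prop` fact.  Unit `lit-balaban-p26` (literature-prover-lit-balaban-p26-g6-0).
-/

noncomputable section

open scoped BigOperators
open Finset

namespace Literature.MathematicalPhysics.QuantumFieldTheory.Balaban1983to89.B8Ineq165Local

open B7Prop1Explicit B7Prop2Explicit B7Prop1Local B8Lemma1NonAbelian B8Ineq129 B8Ineq130 B8Ineq165Descent

-- `Site` alone would resolve to the torus sites of `Setup.lean`; re-export the `ℤ^d` sites of `B7Prop1Explicit`.
export B7Prop1Explicit (Site)

variable {d : ℕ}

variable {𝔸 : Type*} [NormedRing 𝔸] [NormOneClass 𝔸] [NormedAlgebra ℂ 𝔸] [CompleteSpace 𝔸]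

/-- **(1.65) AS PRINTED, LOCAL CARRIER** (p. 87; (1.7) p. 77 *"for p ∈ Ω_j"*): as `B8Ineq165Descent.ineq165_global`,
but with the regularity of `U₀` and `U = U′U₀` ((1.33), (1.34)) assumed on the unit plaquettes of the finest cube
`□̃ = [tlo k, thi k]` ONLY (`pdevOn … < α₀η²`, `η = L^{−k}`): for every depth `n = k − j ≤ k` and every bond `⟨x, x + e_ν⟩
⊂ □̃^{(j)}`, `|Ūʲ(x, x+e_ν) − Ū₀ʲ(x, x+e_ν)| ≤ 8d²α₀(L^{−2(n−1)} + … + 1) + α₁ < 11d²α₀ + α₁`.  Proof: the clamped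
extensions of `U₀|□̃`, `U|□̃` satisfy every hypothesis of `ineq165_global` ((1.19) and (1.35) transfer by the locality of
transport and of the averages (43) on the tower, `B8Ineq130.agree_level`), and their averages agree with those of `U₀`,
`U` on the tower. [cite: Balaban1985RegularSpaces, (1.65) p.87, (1.7) p.77] -/
theorem ineq165_local (L : ℕ) (hL : 2 ≤ L) (hd : 1 ≤ d) {G : Subgroup 𝔸ˣ} (hG : AvgClosed d L G) (k : ℕ)
    (U₀ U : Site d → Fin d → 𝔸ˣ) (hU₀ : ∀ x κ, U₀ x κ ∈ G) (hU : ∀ x κ, U x κ ∈ G)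
    {α₀ α₁ : ℝ} (hα : 0 < α₀) (hα3 : C0 d * α₀ ≤ 1 / 3) (hα2 : 2 * α₀ ≤ c2' d L)
    (lo hi : Site d) (hlohi : lo ≤ hi)
    (h33 : pdevOn (tlo L lo k) (thi L hi k) U₀ < α₀ * (((L : ℝ) ^ k)⁻¹) ^ 2)
    (h34 : pdevOn (tlo L lo k) (thi L hi k) U < α₀ * (((L : ℝ) ^ k)⁻¹) ^ 2)
    (h19 : ∀ n, n < k → ∀ z, tlo L lo n ≤ z → z ≤ thi L hi n → ∀ r : Fin d → Fin L,
      axialFn (avgIter L U (k - (n + 1))) ((L : ℤ) • z) ((L : ℤ) • z + boxVec L r) =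
        axialFn (avgIter L U₀ (k - (n + 1))) ((L : ℤ) • z) ((L : ℤ) • z + boxVec L r))
    (h35 : ∀ x ν, lo ≤ x → x + e ν ≤ hi →
      ‖((avgIter L U k x ν : 𝔸ˣ) : 𝔸) - avgIter L U₀ k x ν‖ ≤ α₁)
    (hα₁ : 0 ≤ α₁) (hsmall : 11 * (d : ℝ) ^ 2 * α₀ + α₁ ≤ 1 / 6)
    (n : ℕ) (hn : n ≤ k) (x : Site d) (ν : Fin d) (hx : tlo L lo n ≤ x) (hxν : x + e ν ≤ thi L hi n) :
    ‖((avgIter L U (k - n) x ν : 𝔸ˣ) : 𝔸) - avgIter L U₀ (k - n) x ν‖ ≤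
        8 * (d : ℝ) ^ 2 * α₀ * (∑ m ∈ Finset.range n, (((L : ℝ) ^ m)⁻¹) ^ 2) + α₁ ∧
      8 * (d : ℝ) ^ 2 * α₀ * (∑ m ∈ Finset.range n, (((L : ℝ) ^ m)⁻¹) ^ 2) + α₁ <
        11 * (d : ℝ) ^ 2 * α₀ + α₁ := by
  have hL1 : 1 ≤ L := le_trans (by norm_num) hL
  have hUU : ∀ x κ, U x κ ∈ U1 𝔸 := fun x κ => hG.le_U1 (hU x κ)
  have hUU₀ : ∀ x κ, U₀ x κ ∈ U1 𝔸 := fun x κ => hG.le_U1 (hU₀ x κ)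
  have hkk : ∀ i, tlo L lo k i ≤ thi L hi k i := tlo_le_thi hL1 hlohi k
  -- the clamped extensions `π*U`, `π*U₀` of the restrictions to the finest cube
  set W := clampCfg (tlo L lo k) (thi L hi k) U with hW
  set W₀ := clampCfg (tlo L lo k) (thi L hi k) U₀ with hW₀
  have hW' : ∀ x κ, W x κ ∈ G := clampCfg_mem hU
  have hW₀' : ∀ x κ, W₀ x κ ∈ G := clampCfg_mem hU₀
  have h34' : pdev W < α₀ * (((L : ℝ) ^ k)⁻¹) ^ 2 := (pdev_clampCfg_le hkk hUU).trans_lt h34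
  have h33' : pdev W₀ < α₀ * (((L : ℝ) ^ k)⁻¹) ^ 2 := (pdev_clampCfg_le hkk hUU₀).trans_lt h33
  -- locality of (43) on the tower: the averages agree on the cubes
  have hA : ∀ j m, m + j = k → AgreeOn (tlo L lo m) (thi L hi m) (avgIter L W j) (avgIter L U j) :=
    fun j m hmj => agree_level hL1 j m (by rw [hmj]; exact clampCfg_agree U)
  have hA₀ : ∀ j m, m + j = k → AgreeOn (tlo L lo m) (thi L hi m) (avgIter L W₀ j) (avgIter L U₀ j) :=
    fun j m hmj => agree_level hL1 j m (by rw [hmj]; exact clampCfg_agree U₀)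
  -- (1.19) transfers
  have h19' : ∀ n, n < k → ∀ z, tlo L lo n ≤ z → z ≤ thi L hi n → ∀ r : Fin d → Fin L,
      axialFn (avgIter L W (k - (n + 1))) ((L : ℤ) • z) ((L : ℤ) • z + boxVec L r) =
        axialFn (avgIter L W₀ (k - (n + 1))) ((L : ℤ) • z) ((L : ℤ) • z + boxVec L r) := by
    intro n hn z hz hz' r
    obtain ⟨h1, h2⟩ := block_mem hz hz' r
    obtain ⟨h3, h4⟩ := smul_mem hL1 hz hz'
    rw [axialFn_congr (hA (k - (n + 1)) (n + 1) (by omega)) _ _ (inBox_of_le h3 h4) (inBox_of_le h1 h2),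
      axialFn_congr (hA₀ (k - (n + 1)) (n + 1) (by omega)) _ _ (inBox_of_le h3 h4) (inBox_of_le h1 h2)]
    exact h19 n hn z hz hz' r
  -- (1.35) transfers
  have h35' : ∀ x ν, lo ≤ x → x + e ν ≤ hi →
      ‖((avgIter L W k x ν : 𝔸ˣ) : 𝔸) - avgIter L W₀ k x ν‖ ≤ α₁ := by
    intro x ν hx hxν
    have hbx := inBox_of_le hx (le_of_add_e_le hxν)
    have hbx' := inBox_of_le (hx.trans (le_add_of_nonneg_right (e_nonneg ν))) hxν
    have e1 := hA k 0 (by simp) x ν (by simpa using hbx) (by simpa using hbx')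
    have e0 := hA₀ k 0 (by simp) x ν (by simpa using hbx) (by simpa using hbx')
    rw [e1, e0]
    exact h35 x ν hx hxν
  have hmain := ineq165_global L hL hd hG k W₀ W hW₀' hW' hα hα3 hα2 h33' h34' lo hi h19' h35' hα₁ hsmall
    n hn x ν hx hxν
  have hbx := inBox_of_le hx (le_of_add_e_le hxν)
  have hbx' := inBox_of_le (hx.trans (le_add_of_nonneg_right (e_nonneg ν))) hxν
  rwa [hA (k - n) n (by omega) x ν hbx hbx', hA₀ (k - n) n (by omega) x ν hbx hbx'] at hmain

/-- **(1.65), the `|Ũ′ʲ − 1|` member, LOCAL CARRIER**: under the hypotheses of `ineq165_local`,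
`|Ũ′ʲ(x, x+e_ν) − 1| < 11d²α₀ + α₁` on `□̃^{(j)}` (`Ũ′ʲ = Ūʲ(Ū₀ʲ)⁻¹` bondwise, (1.20)).
[cite: Balaban1985RegularSpaces, (1.65) p.87, (1.20) p.79] -/
theorem ineq165_local_pert (L : ℕ) (hL : 2 ≤ L) (hd : 1 ≤ d) {G : Subgroup 𝔸ˣ} (hG : AvgClosed d L G) (k : ℕ)
    (U₀ U : Site d → Fin d → 𝔸ˣ) (hU₀ : ∀ x κ, U₀ x κ ∈ G) (hU : ∀ x κ, U x κ ∈ G)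
    {α₀ α₁ : ℝ} (hα : 0 < α₀) (hα3 : C0 d * α₀ ≤ 1 / 3) (hα2 : 2 * α₀ ≤ c2' d L)
    (lo hi : Site d) (hlohi : lo ≤ hi)
    (h33 : pdevOn (tlo L lo k) (thi L hi k) U₀ < α₀ * (((L : ℝ) ^ k)⁻¹) ^ 2)
    (h34 : pdevOn (tlo L lo k) (thi L hi k) U < α₀ * (((L : ℝ) ^ k)⁻¹) ^ 2)
    (h19 : ∀ n, n < k → ∀ z, tlo L lo n ≤ z → z ≤ thi L hi n → ∀ r : Fin d → Fin L,
      axialFn (avgIter L U (k - (n + 1))) ((L : ℤ) • z) ((L : ℤ) • z + boxVec L r) =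
        axialFn (avgIter L U₀ (k - (n + 1))) ((L : ℤ) • z) ((L : ℤ) • z + boxVec L r))
    (h35 : ∀ x ν, lo ≤ x → x + e ν ≤ hi →
      ‖((avgIter L U k x ν : 𝔸ˣ) : 𝔸) - avgIter L U₀ k x ν‖ ≤ α₁)
    (hα₁ : 0 ≤ α₁) (hsmall : 11 * (d : ℝ) ^ 2 * α₀ + α₁ ≤ 1 / 6)
    -- the background average on the bond is unit-norm valued (e.g. from Prop. 2 on a larger domain); needed only
    -- to convert the difference into the perturbation form
    (n : ℕ) (hn : n ≤ k) (x : Site d) (ν : Fin d) (hV₀ : avgIter L U₀ (k - n) x ν ∈ U1 𝔸)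
    (hx : tlo L lo n ≤ x) (hxν : x + e ν ≤ thi L hi n) :
    ‖((pert (avgIter L U (k - n)) (avgIter L U₀ (k - n)) x ν : 𝔸ˣ) : 𝔸) - 1‖ < 11 * (d : ℝ) ^ 2 * α₀ + α₁ := by
  have h := ineq165_local L hL hd hG k U₀ U hU₀ hU hα hα3 hα2 lo hi hlohi h33 h34 h19 h35 hα₁ hsmall
    n hn x ν hx hxν
  have hc : ‖((pert (avgIter L U (k - n)) (avgIter L U₀ (k - n)) x ν : 𝔸ˣ) : 𝔸) - 1‖ ≤
      ‖((avgIter L U (k - n) x ν : 𝔸ˣ) : 𝔸) - avgIter L U₀ (k - n) x ν‖ := norm_pert_le_norm_sub hV₀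
  exact hc.trans_lt (h.1.trans_lt h.2)

end Literature.MathematicalPhysics.QuantumFieldTheory.Balaban1983to89.B8Ineq165Local
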